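import Literature.Analysis.Complex.PerronHigherOrder
import HarnessLib

/-!
# Perron's formula of higher order for a Dirichlet series on the line `Re s = 1`

Trunk: Analysis / Complex (contour integration), continuing `PerronHigherOrder.lean` and serving
Goldston–Pintz–Yıldırım, *Primes in tuples I*, §6 (6.7) and §7 (7.7): the main terms `T_R` of
the Selberg-weight sums are Riesz typical means of Dirichlet series, written as line integrals.
For a Dirichlet series `F(s) = ∑_d a_d d^{−1−s}` with `∑ ‖a_d‖/d² < ∞` (so that `F(1+it)`
converges absolutely, uniformly in `t`), a real `R > 0` and an integer `m ≥ 1`,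

  `(1/2πi) ∫_(1) F(s) R^s s^{−(m+1)} ds = (1/m!) ∑_{d ≤ R} (a_d/d) (log R/d)^m`,

which is Montgomery–Vaughan's (5.22) (Riesz typical means `R_m`, there for all
`σ₀ > max(0, σ_c)`) for the Dirichlet series `∑ (a_d/d) d^{−s}` on the line `σ₀ = 1`, in the
absolutely convergent case. Everything here is PROVED:

* `Literature.Analysis.Complex.integral_dirichletSeries_mul_perronPow` — the displayed identity in parametrised
  form, `∫_{−∞}^{∞} F(1+it) R^{1+it} (1+it)^{−(m+1)} dt = 2π ∑_{d ≤ R} (a_d/d) (log R/d)^m/m!`.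

## Proof

Expand `F`, interchange sum and integral (`MeasureTheory.integral_tsum_of_summable_integral_norm`,
the `d`-th integrand having `L¹` norm `≤ ‖a_d‖ R π/d²` since `‖R^{1+it}(1+it)^{−m−1}‖ ≤ R/(1+t²)`),
and evaluate each term by `Literature.Analysis.Complex.integral_perronPow_vertical` ((6.6) of GPY) at `x = R/d`,
which vanishes for `d > R`.

## References

* H. L. Montgomery, R. C. Vaughan, *Multiplicative Number Theory I. Classical Theory*, Cambridge
  Studies in Advanced Mathematics 97, CUP 2007, §5.1, (5.20)–(5.22), p. 143.
  [cite: MontgomeryVaughan2007]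
* D. A. Goldston, J. Pintz, C. Y. Yıldırım, *Primes in tuples. I*, Ann. of Math. (2) 170 (2009),
  819–862 = arXiv:math/0508185, §6, (6.6)–(6.7), p. 12. [cite: GoldstonPintzYildirim2009]
-/

noncomputable section

open Complex Set Filter Topology MeasureTheory intervalIntegral
open scoped Interval

namespace Literature.Analysis.Complex

/-- `((R/d : ℝ) : ℂ)^s = R^s / d^s` for real `R ≥ 0` and a natural number `d > 0`. [folklore] -/
theorem ofReal_div_natCast_cpow {R : ℝ} (hR : 0 ≤ R) {d : ℕ} (hd : 0 < d) (s : ℂ) :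
    (((R / d : ℝ)) : ℂ) ^ s = (R : ℂ) ^ s / (d : ℂ) ^ s := by
  have hd0 : (0 : ℝ) ≤ (d : ℝ)⁻¹ := by positivity
  rw [div_eq_mul_inv,
    show (((R * (d : ℝ)⁻¹ : ℝ)) : ℂ) = (R : ℂ) * (((d : ℝ)⁻¹ : ℝ) : ℂ) by push_cast; ring,
    Complex.mul_cpow_ofReal_nonneg hR hd0, Complex.ofReal_inv, Complex.ofReal_natCast,
    Complex.inv_cpow _ _ (by rw [Complex.natCast_arg]; exact Real.pi_pos.ne), div_eq_mul_inv]

/-- The termwise identity behind (6.7): `a d^{−(1+s)} · R^s s^{−(m+1)} = (a/d) · (R/d)^s s^{−(m+1)}`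
for `d ≥ 1`, `R ≥ 0`. [cite: GoldstonPintzYildirim2009, Section 6 eq. 6.7] -/
theorem div_cpow_mul_perronPow {R : ℝ} (hR : 0 ≤ R) (a : ℂ) (m : ℕ) {d : ℕ} (hd : 1 ≤ d)
    (s : ℂ) :
    a / (d : ℂ) ^ (1 + s) * perronPow R m s = a / (d : ℂ) * perronPow (R / d) m s := by
  have hd0 : (d : ℂ) ≠ 0 := by exact_mod_cast (show d ≠ 0 by omega)
  unfold perronPow
  rw [ofReal_div_natCast_cpow hR (by omega) s, Complex.cpow_add _ _ hd0, Complex.cpow_one]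
  have hds : (d : ℂ) ^ s ≠ 0 := Complex.cpow_ne_zero_iff.2 (Or.inl hd0)
  field_simp

/-- On the line `Re s = 1` the kernel `x^s s^{−(m+1)}`, `m ≥ 1`, has `L¹` norm at most `x π`:
`∫ ‖x^{1+it} (1+it)^{−m−1}‖ dt ≤ ∫ x dt/(1+t²) = x π` (`x > 0`).
[cite: GoldstonPintzYildirim2009, Section 6 eq. 6.6] -/
theorem integral_norm_perronPow_one_le {x : ℝ} (hx : 0 < x) {m : ℕ} (hm : 1 ≤ m) :
    ∫ t : ℝ, ‖perronPow x m (((1 : ℝ) : ℂ) + t * I)‖ ≤ x * Real.pi := by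
  have hint := (integrable_perronPow_vertical hx hm (one_ne_zero : (1 : ℝ) ≠ 0)).norm
  have hbound : ∀ t : ℝ, ‖perronPow x m (((1 : ℝ) : ℂ) + t * I)‖ ≤ x * (1 + t ^ 2)⁻¹ := by
    intro t
    rw [norm_perronPow hx, Real.rpow_one]
    have hn1 : 1 ≤ ‖((1 : ℝ) : ℂ) + t * I‖ := by
      have := abs_re_le_norm_line 1 t
      rwa [abs_one] at this
    have hsq : ‖((1 : ℝ) : ℂ) + t * I‖ ^ 2 = 1 + t ^ 2 := by
      rw [Complex.sq_norm, Complex.normSq_apply]; simp; ring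
    have hpow : 1 + t ^ 2 ≤ ‖((1 : ℝ) : ℂ) + t * I‖ ^ (m + 1) := by
      rw [← hsq]; exact pow_le_pow_right₀ hn1 (by omega)
    rw [div_eq_mul_inv]
    exact mul_le_mul_of_nonneg_left (inv_anti₀ (by positivity) hpow) hx.le
  calc ∫ t : ℝ, ‖perronPow x m (((1 : ℝ) : ℂ) + t * I)‖ ≤ ∫ t : ℝ, x * (1 + t ^ 2)⁻¹ :=
        integral_mono hint (integrable_inv_one_add_sq.const_mul x) hbound
    _ = x * Real.pi := by rw [MeasureTheory.integral_const_mul, integral_univ_inv_one_add_sq]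

/-- Finite support of the termwise evaluation: if `V d` (the line integral of the `d`-th term,
`d ≥ 1`) equals `2π (log R/d)^m/m!` for `d ≤ R` and `0` for `d > R`, then
`∑'_d (a_d/d) V d = 2π ∑_{1 ≤ d ≤ R} (a_d/d) (log R/d)^m/m!` (the `d = 0` term vanishes in Lean
since `a/0 = 0`). [cite: MontgomeryVaughan2007, Section 5.1 eq. 5.22] -/
theorem tsum_div_mul_perronIntegral_eq_sum {R : ℝ} (hR : 0 < R) (a : ℕ → ℂ) (m : ℕ) (V : ℕ → ℂ)
    (hV : ∀ d : ℕ, 1 ≤ d → V d = if 1 ≤ R / d then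
      2 * Real.pi * (((Real.log (R / d) : ℝ) : ℂ) ^ m / (m.factorial : ℂ)) else 0) :
    ∑' d : ℕ, a d / (d : ℂ) * V d = 2 * Real.pi *
      ∑ d ∈ Finset.Icc 1 ⌊R⌋₊,
        a d / (d : ℂ) * (((Real.log (R / d) : ℝ) : ℂ) ^ m / (m.factorial : ℂ)) := by
  have hsupp : ∀ d : ℕ, d ∉ Finset.Icc 1 ⌊R⌋₊ → a d / (d : ℂ) * V d = 0 := by
    intro d hd
    rw [Finset.mem_Icc, not_and_or, not_le, not_le] at hd
    rcases hd with hd | hd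
    · have : d = 0 := by omega
      subst this
      simp
    · have hd1 : 1 ≤ d := by omega
      rw [hV d hd1]
      have hlt : R / d < 1 := by
        rw [div_lt_one (by exact_mod_cast (show 0 < d by omega))]
        exact (Nat.floor_lt hR.le).1 hd |> fun h => by exact_mod_cast h
      rw [if_neg (not_le.2 hlt), mul_zero]
  rw [tsum_eq_sum (s := Finset.Icc 1 ⌊R⌋₊) (fun d hd => hsupp d hd), Finset.mul_sum]
  refine Finset.sum_congr rfl fun d hd => ?_
  obtain ⟨hd1, hdR⟩ := Finset.mem_Icc.1 hd
  have hd0 : (0 : ℝ) < d := by exact_mod_cast hd1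
  have hRd : 1 ≤ R / d := by
    rw [le_div_iff₀ hd0, one_mul]
    exact le_trans (by exact_mod_cast hdR) (Nat.floor_le hR.le)
  rw [hV d hd1, if_pos hRd]
  ring

/-- **Perron's formula of order `m ≥ 1` for a Dirichlet series on `Re s = 1`** (Riesz typical
means, Montgomery–Vaughan (5.22) at `σ₀ = 1` in the absolutely convergent case; the Mellin
inversion of GPY (6.7)/(7.7)). If `∑_d ‖a_d‖/d² < ∞`, `R > 0` and `m ≥ 1`, then
`∫_{−∞}^{∞} (∑_d a_d d^{−(1+s)}) R^{s} s^{−(m+1)} dt = 2π ∑_{1 ≤ d ≤ R} (a_d/d) (log R/d)^m / m!`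
with `s = 1 + it`, i.e. `(1/2πi) ∫_(1) F(s) R^s s^{−m−1} ds = (1/m!) ∑_{d ≤ R} (a_d/d)(log R/d)^m`
for `F(s) = ∑ a_d d^{−1−s}`; sum and integral are interchanged by absolute convergence
(`integral_norm_perronPow_one_le`) and each term is `Literature.Analysis.Complex.integral_perronPow_vertical` at
`x = R/d`. [cite: MontgomeryVaughan2007, Section 5.1 eq. 5.22] -/
theorem integral_dirichletSeries_mul_perronPow {a : ℕ → ℂ}
    (ha : Summable fun d : ℕ => ‖a d‖ / (d : ℝ) ^ 2) {R : ℝ} (hR : 0 < R) {m : ℕ} (hm : 1 ≤ m) :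
    ∫ t : ℝ, (∑' d : ℕ, a d / (d : ℂ) ^ (1 + (((1 : ℝ) : ℂ) + t * I))) *
        perronPow R m (((1 : ℝ) : ℂ) + t * I) =
      2 * Real.pi * ∑ d ∈ Finset.Icc 1 ⌊R⌋₊,
        a d / (d : ℂ) * (((Real.log (R / d) : ℝ) : ℂ) ^ m / (m.factorial : ℂ)) := by
  set term : ℕ → ℝ → ℂ := fun d t =>
    a d / (d : ℂ) * perronPow (R / d) m (((1 : ℝ) : ℂ) + t * I) with hterm
  -- (a) pointwise expansion
  have hpt : ∀ t : ℝ, (∑' d : ℕ, a d / (d : ℂ) ^ (1 + (((1 : ℝ) : ℂ) + t * I))) *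
      perronPow R m (((1 : ℝ) : ℂ) + t * I) = ∑' d : ℕ, term d t := by
    intro t
    rw [← tsum_mul_right]
    refine tsum_congr fun d => ?_
    rcases Nat.eq_zero_or_pos d with rfl | hd
    · have h2 : (1 : ℂ) + (((1 : ℝ) : ℂ) + t * I) ≠ 0 := by
        intro h; have := congrArg Complex.re h; simp at this
      simp only [hterm, Nat.cast_zero, Complex.zero_cpow h2, div_zero, zero_mul]
    · exact div_cpow_mul_perronPow hR.le (a d) m hd _
  -- (b) integrability of each term
  have hint : ∀ d : ℕ, Integrable (term d) := by
    intro d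
    rcases Nat.eq_zero_or_pos d with rfl | hd
    · have : term 0 = fun _ => 0 := by funext t; simp [hterm]
      rw [this]; exact integrable_zero _ _ _
    · have hx : 0 < R / d := div_pos hR (by exact_mod_cast hd)
      exact (integrable_perronPow_vertical hx hm (one_ne_zero : (1 : ℝ) ≠ 0)).const_mul _
  -- (c) summability of the `L¹` norms
  have hsum : Summable fun d : ℕ => ∫ t : ℝ, ‖term d t‖ := by
    refine Summable.of_nonneg_of_le (fun d => integral_nonneg fun t => norm_nonneg _)
      (fun d => ?_) (ha.mul_left (R * Real.pi))
    rcases Nat.eq_zero_or_pos d with rfl | hd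
    · simp [hterm]
    · have hd0 : (0 : ℝ) < d := by exact_mod_cast hd
      have hx : 0 < R / d := div_pos hR hd0
      calc ∫ t : ℝ, ‖term d t‖
          = ‖a d / (d : ℂ)‖ * ∫ t : ℝ, ‖perronPow (R / d) m (((1 : ℝ) : ℂ) + t * I)‖ := by
            simp only [hterm, norm_mul]
            rw [MeasureTheory.integral_const_mul]
        _ ≤ ‖a d‖ / d * (R / d * Real.pi) := by
            rw [norm_div, Complex.norm_natCast]
            exact mul_le_mul_of_nonneg_left (integral_norm_perronPow_one_le hx hm)
              (by positivity)
        _ = R * Real.pi * (‖a d‖ / (d : ℝ) ^ 2) := by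
            field_simp
  -- (d) interchange and evaluate termwise
  rw [show (fun t : ℝ => (∑' d : ℕ, a d / (d : ℂ) ^ (1 + (((1 : ℝ) : ℂ) + t * I))) *
      perronPow R m (((1 : ℝ) : ℂ) + t * I)) = fun t => ∑' d : ℕ, term d t from funext hpt,
    ← integral_tsum_of_summable_integral_norm hint hsum]
  have hV : ∀ d : ℕ, ∫ t : ℝ, term d t =
      a d / (d : ℂ) * ∫ t : ℝ, perronPow (R / d) m (((1 : ℝ) : ℂ) + t * I) :=
    fun d => MeasureTheory.integral_const_mul _ _
  simp_rw [hV]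
  refine tsum_div_mul_perronIntegral_eq_sum hR a m
    (fun d => ∫ t : ℝ, perronPow (R / d) m (((1 : ℝ) : ℂ) + t * I)) fun d hd => ?_
  have hx : 0 < R / d := div_pos hR (by exact_mod_cast hd)
  rw [integral_perronPow_vertical hx one_pos hm]

end Literature.Analysis.Complex
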